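import Summits.RiemannHypothesis.RiemannHypothesis.Theorems.RuelleBandCofiniteCriticalLineStubZeroLevelWindowAux
import Mathlib.Topology.Order.IntermediateValue
import HarnessLib

/-!
# Line `cofinite-weil-index-staircase`, stub `stub_zeroLevelWindow` (the intermediate value step)

Stub file (`--supports stmt-RiemannHypothesis-2064`, crux `RuelleBand.CofiniteCriticalLine`,
line `cofinite-weil-index-staircase`).  Normalisation of
`Literature/NumberTheory/LFunctions/WeilExplicit.lean` (`Q = weilQuadratic`, tests `IsWeilTest`).

Dictionary (written out verbatim in every statement, no local definitions):
* `Inner(g) = {Re Q(∑ cᵢ gᵢ) : ∫ ‖∑ cᵢ gᵢ‖² = 1}` for a tuple `g : Fin (k+1) → ℝ → ℂ`;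
* `Outer(a, k) = {sSup Inner(g) : g linearly independent window-[-a, a] test functions}`;
* `level a k = sInf Outer(a, k)` — the `k`-th Courant–Fischer level of the window form;
* `WindowIndexLE a N` — every `(N+1)`-tuple of window tests has a coefficient vector `c ≠ 0` with
  `Re Q(∑ cᵢ gᵢ) ≥ 0`.

Proved here:
* `stub_zeroLevelWindow_isCompact_sphere` — for linearly independent tests the unit `L²`-sphere
  `K(g) = {c | ∫ ‖∑ cᵢ gᵢ‖² = 1}` of the coefficient space is COMPACT (closed by continuity,
  bounded by coercivity `m ‖c‖² ≤ ∫ ‖∑ cᵢ gᵢ‖²`, `m > 0` the minimum on the unit sphere);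
  hence `Inner(g)` is compact and nonempty, its `sSup` is attained
  (`stub_zeroLevelWindow_sSup_inner_mem`);
* the DICTIONARY: `WindowIndexLE a N → 0 ≤ level a N` (`stub_zeroLevelWindow_level_nonneg`,
  normalise the witness) and `¬ WindowIndexLE a N → level a N < 0`
  (`stub_zeroLevelWindow_level_neg`: the failing tuple is linearly independent, its attained `sSup`
  is `< 0`, and `Outer` is bounded below by Bombieri's window constant,
  `bddBelow_weilQuadratic_sphere_holds`);
* the registered stub `stub_zeroLevelWindow`: with the branch continuity hypothesis, the
  intermediate value theorem (`intermediate_value_Icc'`) on `[a₁, a₂] ⊆ (0, ∞)` yields a window with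
  `level a N = 0`.

Sources: R. Courant–D. Hilbert, *Methods of Mathematical Physics* I, Ch. VI §1 (min–max levels);
E. Bombieri, Rend. Lincei (9) 11 (2000) §4 (lower bound on the unit sphere). Everything is proved
from the tree; no named facts, no definitions.
-/

-- the namespace segment `RiemannHypothesis` repeats (single-problem summit); harmless here
set_option linter.dupNamespace false

noncomputable section

open Complex MeasureTheory Filter Set
open scoped BigOperators Topology ComplexConjugate

namespace Summit.RiemannHypothesis.RiemannHypothesis.Theorems.RuelleBandCofiniteCriticalLine

open Literature.NumberTheory.LFunctions

/-! ### The unit `L²`-sphere of a finite span is compact -/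

/-- **Coercivity**: for a linearly independent tuple of test functions there is `m > 0` with
`m ‖c‖² ≤ ∫ ‖∑ cᵢ gᵢ‖²` (minimum of the continuous, positive function on the compact unit sphere
of the coefficient space, and `2`-homogeneity). [folklore] -/
theorem stub_zeroLevelWindow_coercive {k : ℕ} {g : Fin (k + 1) → ℝ → ℂ}
    (hg : ∀ i, IsWeilTest (g i)) (hli : LinearIndependent ℂ g) :
    ∃ m : ℝ, 0 < m ∧ ∀ c : Fin (k + 1) → ℂ, m * ‖c‖ ^ 2 ≤ ∫ t, ‖∑ i, c i * g i t‖ ^ 2 := by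
  have hcont := stub_zeroLevelWindow_continuous_normSq hg
  have hS : (Metric.sphere (0 : Fin (k + 1) → ℂ) 1).Nonempty :=
    NormedSpace.sphere_nonempty.2 zero_le_one
  obtain ⟨c₀, hc₀, hmin⟩ :=
    (isCompact_sphere (0 : Fin (k + 1) → ℂ) 1).exists_isMinOn hS hcont.continuousOn
  have hc₀ne : c₀ ≠ 0 := by
    rintro rfl
    simp at hc₀
  refine ⟨_, stub_zeroLevelWindow_normSq_pos hg hli hc₀ne, fun c => ?_⟩
  by_cases hc : c = 0
  · subst hc
    simp
  · have hcn : 0 < ‖c‖ := norm_pos_iff.2 hc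
    have h2 : 0 < ‖c‖ ^ 2 := by positivity
    have hu : (fun i => ((‖c‖⁻¹ : ℝ) : ℂ) * c i) ∈ Metric.sphere (0 : Fin (k + 1) → ℂ) 1 := by
      rw [mem_sphere_zero_iff_norm, show (fun i => ((‖c‖⁻¹ : ℝ) : ℂ) * c i) =
        ((‖c‖⁻¹ : ℝ) : ℂ) • c from rfl, norm_smul, Complex.norm_real,
        Real.norm_of_nonneg (inv_nonneg.2 hcn.le), inv_mul_cancel₀ hcn.ne']
    have h1 := isMinOn_iff.1 hmin _ hu
    rw [stub_zeroLevelWindow_normSq_smul, inv_pow, inv_mul_eq_div, le_div_iff₀ h2] at h1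
    exact h1

/-- **The unit `L²`-sphere `K(g) = {c | ∫ ‖∑ cᵢ gᵢ‖² = 1}` of the span of a linearly independent
tuple of test functions is compact** (closed by continuity, bounded by coercivity; the coefficient
space is finite-dimensional). [folklore] -/
private theorem stub_zeroLevelWindow_isCompact_sphere {k : ℕ} {g : Fin (k + 1) → ℝ → ℂ}
    (hg : ∀ i, IsWeilTest (g i)) (hli : LinearIndependent ℂ g) :
    IsCompact {c : Fin (k + 1) → ℂ | ∫ t, ‖∑ i, c i * g i t‖ ^ 2 = (1 : ℝ)} := by
  obtain ⟨m, hm, hbound⟩ := stub_zeroLevelWindow_coercive hg hli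
  refine Metric.isCompact_of_isClosed_isBounded
    (isClosed_eq (stub_zeroLevelWindow_continuous_normSq hg) continuous_const) ?_
  refine isBounded_iff_forall_norm_le.2 ⟨Real.sqrt (1 / m), fun c hc => ?_⟩
  apply Real.le_sqrt_of_sq_le
  rw [le_div_iff₀ hm]
  have h1 := hbound c
  have hc' : ∫ t, ‖∑ i, c i * g i t‖ ^ 2 = 1 := hc
  rw [hc'] at h1
  linarith

/-! ### The inner set `{Re Q(∑ cᵢ gᵢ) : ∫ ‖∑ cᵢ gᵢ‖² = 1}` -/

/-- The inner set is the image of the unit `L²`-sphere of the span under `c ↦ Re Q(∑ cᵢ gᵢ)`.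
[folklore] -/
theorem stub_zeroLevelWindow_inner_eq_image {k : ℕ} (g : Fin (k + 1) → ℝ → ℂ) :
    {y : ℝ | ∃ c : Fin (k + 1) → ℂ, ∫ t, ‖∑ i, c i * g i t‖ ^ 2 = (1 : ℝ) ∧
        y = (weilQuadratic (fun t => ∑ i, c i * g i t)).re} =
      (fun c : Fin (k + 1) → ℂ => (weilQuadratic (fun t => ∑ i, c i * g i t)).re) ''
        {c : Fin (k + 1) → ℂ | ∫ t, ‖∑ i, c i * g i t‖ ^ 2 = (1 : ℝ)} := by
  ext y
  simp only [Set.mem_image, Set.mem_setOf_eq]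
  constructor
  · rintro ⟨c, hc, rfl⟩
    exact ⟨c, hc, rfl⟩
  · rintro ⟨c, hc, rfl⟩
    exact ⟨c, hc, rfl⟩

/-- **The inner set is compact** for a linearly independent tuple of test functions (continuous
image of the compact sphere `K(g)`). [folklore] -/
theorem stub_zeroLevelWindow_isCompact_inner {k : ℕ} {g : Fin (k + 1) → ℝ → ℂ}
    (hg : ∀ i, IsWeilTest (g i)) (hli : LinearIndependent ℂ g) :
    IsCompact {y : ℝ | ∃ c : Fin (k + 1) → ℂ, ∫ t, ‖∑ i, c i * g i t‖ ^ 2 = (1 : ℝ) ∧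
        y = (weilQuadratic (fun t => ∑ i, c i * g i t)).re} := by
  rw [stub_zeroLevelWindow_inner_eq_image]
  exact (stub_zeroLevelWindow_isCompact_sphere hg hli).image
    (Complex.continuous_re.comp (stub_zeroLevelWindow_continuous_weilQuadratic hg))

/-- **The inner set is nonempty** for a linearly independent tuple of test functions (normalise
the combination with all coefficients `1`). [folklore] -/
theorem stub_zeroLevelWindow_inner_nonempty {k : ℕ} {g : Fin (k + 1) → ℝ → ℂ}
    (hg : ∀ i, IsWeilTest (g i)) (hli : LinearIndependent ℂ g) :
    {y : ℝ | ∃ c : Fin (k + 1) → ℂ, ∫ t, ‖∑ i, c i * g i t‖ ^ 2 = (1 : ℝ) ∧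
        y = (weilQuadratic (fun t => ∑ i, c i * g i t)).re}.Nonempty := by
  have h1 : (fun _ : Fin (k + 1) => (1 : ℂ)) ≠ 0 := fun h => by simpa using congr_fun h 0
  obtain ⟨r, -, hr⟩ := stub_zeroLevelWindow_normalise hg hli h1
  exact ⟨_, fun i => (r : ℂ) * 1, hr, rfl⟩

/-- **The supremum of the inner set is attained**: there is `c` on the unit `L²`-sphere of the
span with `sSup {Re Q} = Re Q(∑ cᵢ gᵢ)`. [folklore] -/
theorem stub_zeroLevelWindow_sSup_inner_mem {k : ℕ} {g : Fin (k + 1) → ℝ → ℂ}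
    (hg : ∀ i, IsWeilTest (g i)) (hli : LinearIndependent ℂ g) :
    ∃ c : Fin (k + 1) → ℂ, ∫ t, ‖∑ i, c i * g i t‖ ^ 2 = (1 : ℝ) ∧
      sSup {y : ℝ | ∃ c : Fin (k + 1) → ℂ, ∫ t, ‖∑ i, c i * g i t‖ ^ 2 = (1 : ℝ) ∧
        y = (weilQuadratic (fun t => ∑ i, c i * g i t)).re} =
      (weilQuadratic (fun t => ∑ i, c i * g i t)).re :=
  (stub_zeroLevelWindow_isCompact_inner hg hli).sSup_mem
    (stub_zeroLevelWindow_inner_nonempty hg hli)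

/-- The inner set is bounded above. [folklore] -/
private theorem stub_zeroLevelWindow_bddAbove_inner {k : ℕ} {g : Fin (k + 1) → ℝ → ℂ}
    (hg : ∀ i, IsWeilTest (g i)) (hli : LinearIndependent ℂ g) :
    BddAbove {y : ℝ | ∃ c : Fin (k + 1) → ℂ, ∫ t, ‖∑ i, c i * g i t‖ ^ 2 = (1 : ℝ) ∧
        y = (weilQuadratic (fun t => ∑ i, c i * g i t)).re} :=
  (stub_zeroLevelWindow_isCompact_inner hg hli).bddAbove

/-! ### The dictionary: sign of the level versus the window index bound -/

/-- A tuple on which `Re Q` is negative definite (on non-zero coefficient vectors) is linearly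
independent: a vanishing combination with `c ≠ 0` would give `Re Q(0) = 0 < 0`. [folklore] -/
theorem stub_zeroLevelWindow_linearIndependent_of_neg {n : ℕ} {g : Fin n → ℝ → ℂ}
    (hneg : ∀ c : Fin n → ℂ, c ≠ 0 → (weilQuadratic (fun t => ∑ i, c i * g i t)).re < 0) :
    LinearIndependent ℂ g := by
  rw [Fintype.linearIndependent_iff]
  intro c hc
  by_contra hne
  push Not at hne
  obtain ⟨i, hi⟩ := hne
  have hc0 : c ≠ 0 := fun h => hi (by simp [h])
  have h := hneg c hc0
  rw [stub_zeroLevelWindow_sum_eq, hc, weilQuadratic_zero, Complex.zero_re] at h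
  exact lt_irrefl _ h

/-- If `Re Q` is negative definite on the span of the test functions `gᵢ`, then the (attained)
supremum of `Re Q` over the unit `L²`-sphere of the span is negative. [folklore] -/
theorem stub_zeroLevelWindow_sSup_inner_neg {k : ℕ} {g : Fin (k + 1) → ℝ → ℂ}
    (hg : ∀ i, IsWeilTest (g i))
    (hneg : ∀ c : Fin (k + 1) → ℂ, c ≠ 0 → (weilQuadratic (fun t => ∑ i, c i * g i t)).re < 0) :
    sSup {y : ℝ | ∃ c : Fin (k + 1) → ℂ, ∫ t, ‖∑ i, c i * g i t‖ ^ 2 = (1 : ℝ) ∧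
        y = (weilQuadratic (fun t => ∑ i, c i * g i t)).re} < 0 := by
  obtain ⟨c, hc1, hsup⟩ :=
    stub_zeroLevelWindow_sSup_inner_mem hg (stub_zeroLevelWindow_linearIndependent_of_neg hneg)
  rw [hsup]
  refine hneg c ?_
  rintro rfl
  simp at hc1

/-- If every `(k+1)`-tuple of window tests carries a non-zero coefficient vector with
`Re Q ≥ 0` (the window index bound), then for a linearly independent tuple of window tests the
supremum of `Re Q` over the unit `L²`-sphere of its span is `≥ 0` (normalise the witness).
[folklore] -/
theorem stub_zeroLevelWindow_sSup_inner_nonneg {k : ℕ} {a : ℝ} {g : Fin (k + 1) → ℝ → ℂ}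
    (hpos : ∀ g : Fin (k + 1) → ℝ → ℂ, (∀ i, IsWeilTest (g i)) →
      (∀ i, tsupport (g i) ⊆ Set.Icc (-a) a) →
      ∃ c : Fin (k + 1) → ℂ, c ≠ 0 ∧ 0 ≤ (weilQuadratic (fun t => ∑ i, c i * g i t)).re)
    (hg : ∀ i, IsWeilTest (g i) ∧ tsupport (g i) ⊆ Set.Icc (-a) a)
    (hli : LinearIndependent ℂ g) :
    0 ≤ sSup {y : ℝ | ∃ c : Fin (k + 1) → ℂ, ∫ t, ‖∑ i, c i * g i t‖ ^ 2 = (1 : ℝ) ∧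
        y = (weilQuadratic (fun t => ∑ i, c i * g i t)).re} := by
  obtain ⟨c, hc, hQ⟩ := hpos g (fun i => (hg i).1) (fun i => (hg i).2)
  obtain ⟨r, -, h1⟩ := stub_zeroLevelWindow_normalise (fun i => (hg i).1) hli hc
  refine Real.sSup_nonneg' ⟨_, ⟨fun i => (r : ℂ) * c i, h1, rfl⟩, ?_⟩
  rw [stub_zeroLevelWindow_re_weilQuadratic_smul]
  positivity

/-- **The outer set is bounded below** (by Bombieri's window constant,
`bddBelow_weilQuadratic_sphere_holds`: each `sSup` over a unit sphere of a span of window tests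
dominates an element of the window's unit-sphere value set). [folklore] -/
theorem stub_zeroLevelWindow_bddBelow_outer (a : ℝ) (k : ℕ) :
    BddBelow {x : ℝ | ∃ g : Fin (k + 1) → ℝ → ℂ,
      (∀ i, IsWeilTest (g i) ∧ tsupport (g i) ⊆ Set.Icc (-a) a) ∧ LinearIndependent ℂ g ∧
      x = sSup {y : ℝ | ∃ c : Fin (k + 1) → ℂ,
        ∫ t, ‖∑ i, c i * g i t‖ ^ 2 = (1 : ℝ) ∧
        y = (weilQuadratic (fun t => ∑ i, c i * g i t)).re}} := by
  obtain ⟨C, hC⟩ := bddBelow_weilQuadratic_sphere_holds a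
  refine ⟨C, ?_⟩
  rintro x ⟨g, hg, hli, rfl⟩
  have hg1 : ∀ i, IsWeilTest (g i) := fun i => (hg i).1
  obtain ⟨y, c, hc1, rfl⟩ := stub_zeroLevelWindow_inner_nonempty hg1 hli
  have hF : IsWeilTest (fun t => ∑ i, c i * g i t) := by
    rw [stub_zeroLevelWindow_sum_eq]
    exact stub_zeroLevelWindow_isWeilTest_sum Finset.univ c hg1
  have hy : C ≤ (weilQuadratic (fun t => ∑ i, c i * g i t)).re :=
    hC ⟨_, hF, stub_zeroLevelWindow_tsupport_sum_subset (fun i => (hg i).2) c, hc1, rfl⟩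
  exact hy.trans (le_csSup (stub_zeroLevelWindow_bddAbove_inner hg1 hli) ⟨c, hc1, rfl⟩)

/-- **Dictionary, non-negative side**: the window index bound `≤ k` on `[-a, a]` forces the
`k`-th level to be `≥ 0`. [folklore] -/
theorem stub_zeroLevelWindow_level_nonneg {k : ℕ} {a : ℝ}
    (hpos : ∀ g : Fin (k + 1) → ℝ → ℂ, (∀ i, IsWeilTest (g i)) →
      (∀ i, tsupport (g i) ⊆ Set.Icc (-a) a) →
      ∃ c : Fin (k + 1) → ℂ, c ≠ 0 ∧ 0 ≤ (weilQuadratic (fun t => ∑ i, c i * g i t)).re) :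
    0 ≤ sInf {x : ℝ | ∃ g : Fin (k + 1) → ℝ → ℂ,
      (∀ i, IsWeilTest (g i) ∧ tsupport (g i) ⊆ Set.Icc (-a) a) ∧ LinearIndependent ℂ g ∧
      x = sSup {y : ℝ | ∃ c : Fin (k + 1) → ℂ,
        ∫ t, ‖∑ i, c i * g i t‖ ^ 2 = (1 : ℝ) ∧
        y = (weilQuadratic (fun t => ∑ i, c i * g i t)).re}} := by
  refine Real.sInf_nonneg ?_
  rintro x ⟨g, hg, hli, rfl⟩
  exact stub_zeroLevelWindow_sSup_inner_nonneg hpos hg hli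

/-- **Dictionary, negative side**: if the window index bound `≤ k` FAILS on `[-a, a]`, the `k`-th
level is `< 0` (the failing tuple is linearly independent, its attained `sSup` is negative, and the
outer set is bounded below). [folklore] -/
theorem stub_zeroLevelWindow_level_neg {k : ℕ} {a : ℝ}
    (hnot : ¬ ∀ g : Fin (k + 1) → ℝ → ℂ, (∀ i, IsWeilTest (g i)) →
      (∀ i, tsupport (g i) ⊆ Set.Icc (-a) a) →
      ∃ c : Fin (k + 1) → ℂ, c ≠ 0 ∧ 0 ≤ (weilQuadratic (fun t => ∑ i, c i * g i t)).re) :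
    sInf {x : ℝ | ∃ g : Fin (k + 1) → ℝ → ℂ,
      (∀ i, IsWeilTest (g i) ∧ tsupport (g i) ⊆ Set.Icc (-a) a) ∧ LinearIndependent ℂ g ∧
      x = sSup {y : ℝ | ∃ c : Fin (k + 1) → ℂ,
        ∫ t, ‖∑ i, c i * g i t‖ ^ 2 = (1 : ℝ) ∧
        y = (weilQuadratic (fun t => ∑ i, c i * g i t)).re}} < 0 := by
  push Not at hnot
  obtain ⟨g, hg, hsupp, hneg⟩ := hnot
  have hli := stub_zeroLevelWindow_linearIndependent_of_neg hneg
  exact lt_of_le_of_lt (csInf_le (stub_zeroLevelWindow_bddBelow_outer a k)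
    ⟨g, fun i => ⟨hg i, hsupp i⟩, hli, rfl⟩) (stub_zeroLevelWindow_sSup_inner_neg hg hneg)

/-! ### The stub -/

/-- **Stub `stub_zeroLevelWindow` of the line `cofinite-weil-index-staircase`** (intermediate
value step of "the index staircase only steps at conjugate windows").  Given continuity of every
Courant–Fischer branch `a ↦ level a k` on `(0, ∞)` (hypothesis), if the window index bound `≤ N`
holds on `[-a₁, a₁]` (`a₁ > 0`) but fails on `[-a₂, a₂]` (`a₂ ≥ a₁`), then the `N`-th level
vanishes at some window `a ∈ [a₁, a₂]`: by the dictionary the level is `≥ 0` at `a₁` and `< 0` at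
`a₂`, and the intermediate value theorem applies on `[a₁, a₂] ⊆ (0, ∞)`. [folklore] -/
theorem stub_zeroLevelWindow :
    (∀ k : ℕ, ContinuousOn (fun a : ℝ =>
        sInf {x : ℝ | ∃ g : Fin (k + 1) → ℝ → ℂ,
          (∀ i, IsWeilTest (g i) ∧ tsupport (g i) ⊆ Set.Icc (-a) a) ∧ LinearIndependent ℂ g ∧
          x = sSup {y : ℝ | ∃ c : Fin (k + 1) → ℂ,
            ∫ t, ‖∑ i, c i * g i t‖ ^ 2 = (1 : ℝ) ∧
            y = (weilQuadratic (fun t => ∑ i, c i * g i t)).re}}) (Set.Ioi 0)) →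
    ∀ (N : ℕ) (a₁ a₂ : ℝ), 0 < a₁ → a₁ ≤ a₂ →
      (∀ g : Fin (N + 1) → ℝ → ℂ, (∀ i, IsWeilTest (g i)) →
          (∀ i, tsupport (g i) ⊆ Set.Icc (-a₁) a₁) →
          ∃ c : Fin (N + 1) → ℂ, c ≠ 0 ∧ 0 ≤ (weilQuadratic (fun t => ∑ i, c i * g i t)).re) →
      (¬ ∀ g : Fin (N + 1) → ℝ → ℂ, (∀ i, IsWeilTest (g i)) →
          (∀ i, tsupport (g i) ⊆ Set.Icc (-a₂) a₂) →
          ∃ c : Fin (N + 1) → ℂ, c ≠ 0 ∧ 0 ≤ (weilQuadratic (fun t => ∑ i, c i * g i t)).re) →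
      ∃ a ∈ Set.Icc a₁ a₂,
        sInf {x : ℝ | ∃ g : Fin (N + 1) → ℝ → ℂ,
          (∀ i, IsWeilTest (g i) ∧ tsupport (g i) ⊆ Set.Icc (-a) a) ∧ LinearIndependent ℂ g ∧
          x = sSup {y : ℝ | ∃ c : Fin (N + 1) → ℂ,
            ∫ t, ‖∑ i, c i * g i t‖ ^ 2 = (1 : ℝ) ∧
            y = (weilQuadratic (fun t => ∑ i, c i * g i t)).re}} = 0 := by
  intro hcont N a₁ a₂ ha₁ h₁₂ hle hnot
  set f : ℝ → ℝ := fun a => sInf {x : ℝ | ∃ g : Fin (N + 1) → ℝ → ℂ,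
    (∀ i, IsWeilTest (g i) ∧ tsupport (g i) ⊆ Set.Icc (-a) a) ∧ LinearIndependent ℂ g ∧
    x = sSup {y : ℝ | ∃ c : Fin (N + 1) → ℂ,
      ∫ t, ‖∑ i, c i * g i t‖ ^ 2 = (1 : ℝ) ∧
      y = (weilQuadratic (fun t => ∑ i, c i * g i t)).re}} with hf
  have hf₁ : 0 ≤ f a₁ := stub_zeroLevelWindow_level_nonneg hle
  have hf₂ : f a₂ < 0 := stub_zeroLevelWindow_level_neg hnot
  have hcf : ContinuousOn f (Set.Icc a₁ a₂) :=
    (hcont N).mono fun a ha => lt_of_lt_of_le ha₁ ha.1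
  obtain ⟨a, ha, hfa⟩ := intermediate_value_Icc' h₁₂ hcf ⟨hf₂.le, hf₁⟩
  exact ⟨a, ha, hfa⟩

end Summit.RiemannHypothesis.RiemannHypothesis.Theorems.RuelleBandCofiniteCriticalLine

end
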